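import Mathlib
import Summits.Ventures.HodgeRepro.Tier4.Line1.OrbitalNonzero
import Summits.Ventures.HodgeRepro.Tier4.Line4.DistributionNonzero

/-!
# Tier4/Line4/DistributionNonzeroPair — the weak W5 in CONVOLUTION form, the shape `W3Reduction`'s `hJ` consumes:
`∃ f₁ f₂ test functions, R.Jc (S.conv f₁ f₂) ≠ 0` on `Setting.ofAdelicData` (L1-p2's J2.c′
`exists_pair_orbital_ne_zero` + this line's isolation and `Jc_eq_orbital_of_isolated`)

Blind re-derivation cell `pub-hodge-repro`, Tier 4 «prove the step» (README §9–§10), seat t4-L4-p2 (gen 2; LINE L4).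
Tree path `lean/Summits/Ventures/HodgeRepro/Tier4/Line4/DistributionNonzeroPair.lean`.  Imports L1-p2's
`Line1/OrbitalNonzero` (`exists_pair_orbital_ne_zero`: a pair `f₁, f₂` with `f₁ ⋆ f₂` a test function supported in a
given open `U ∋ γ₀` and `O_{[γ₀]}(f₁ ⋆ f₂) ≠ 0`) and this line's `DistributionNonzero` (`exists_isolating_nbhd`,
`isRegularRational_of_isLinRegular`).

WHAT IS PROVED.  `exists_pair_test_Jc_conv_ne_zero_of_data`: on `S := Setting.ofAdelicData W R μ DG fdG compG compT
compT'` with `IsDefinite W`, `IsGenuineRow W`, continuous unitary characters and a linearly regular rational `γ₀`,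
there are test functions `f₁, f₂` with `R.Jc (S.conv f₁ f₂) ≠ 0` — L1-p5's `W3Reduction.mixed_two_torus_W3_of_spectral_data`
takes exactly this `hJ` (p678480); what that reduction still displays for the SAME pair — the Hecke eigen-relations
`ha`/`hb`, the projector vanishing `hvan`, the adapted ONB and the block spans — is the wall's content (a pair that
ISOLATES the identity double coset AND acts on the admissible blocks as the displayed projectors: W5 proper, census
v0.7 V5.7).  `exists_pair_test_Jc_conv_ne_zero`: with the cocompactness of `G(k)\G(𝔸)` from L1-p5's
`quotient_compact_genuine` and the regular element from L1-p3's `exists_regular_rational`.  Nothing on the wall is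
closed.  HC_CM is NOT proved by anyone in this repository.
-/

set_option autoImplicit false

noncomputable section

namespace Summit.Ventures.HodgeRepro.Tier4.Line4

open Summit.Ventures.HodgeRepro.Tier4.Common Summit.Ventures.HodgeRepro.Tier4.Line1 MeasureTheory NumberField
  Topology

section Pair

variable {k : Type} [Field k] [NumberField k] (W : PlaneData k) [MeasurableSpace (GA W)] [BorelSpace (GA W)]
  (R : RTFData W) [R.μT.IsHaarMeasure] [R.μT'.IsHaarMeasure]

/-- **The weak W5 in convolution form, on given data.** -/
theorem exists_pair_test_Jc_conv_ne_zero_of_data (μ : Measure (GA W)) [μ.IsHaarMeasure] (DG : Set (GA W))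
    (fdG : IsFundamentalDomain (rationalPoints W) DG μ) (compG : IsCompact (closure DG))
    (compT : IsCompact (closure R.DT)) (compT' : IsCompact (closure R.DT')) (hW : IsDefinite W) (hg : IsGenuineRow W)
    (hc : Continuous R.chi) (hu : ∀ a, ‖R.chi a‖ = 1) (hc' : Continuous R.chi') (hu' : ∀ a, ‖R.chi' a‖ = 1)
    (γ₀ : rationalPoints W) (hreg : IsLinRegular W γ₀) :
    ∃ f₁ f₂ : GA W → ℂ, IsTestFn W f₁ ∧ IsTestFn W f₂ ∧
      R.Jc ((Setting.ofAdelicData W R μ DG fdG compG compT compT').conv f₁ f₂) ≠ 0 := by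
  set S := Setting.ofAdelicData W R μ DG fdG compG compT compT' with hS
  haveI : T2Space (GA W) := t2Space_GA W
  haveI : LocallyCompactSpace (GA W) := locallyCompact_GA W
  haveI : Countable S.Gk := rationalPoints_countable W
  obtain ⟨U, hU, hγU, hiso⟩ := exists_isolating_nbhd W R μ DG fdG compG compT compT' hW hg γ₀ hreg
  obtain ⟨f₁, f₂, h₁, h₂, hconv, hsupp, hne⟩ := S.exists_pair_orbital_ne_zero
    (isCharacter_chi W R μ DG fdG compG compT compT' hc hu)
    (isCharacter'_chi' W R μ DG fdG compG compT compT' hc' hu') R.chi_centre γ₀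
    (isRegularRational_of_isLinRegular W γ₀ hreg) hU hγU
  refine ⟨f₁, f₂, ⟨h₁.cont, h₁.compact⟩, ⟨h₂.cont, h₂.compact⟩, ?_⟩
  have hgeo : S.geoSupport (S.conv f₁ f₂) = {S.orbitOf γ₀} := by
    apply Set.eq_singleton_iff_unique_mem.2
    refine ⟨?_, ?_⟩
    · by_contra hnot
      exact hne (S.orbital_eq_zero_of_not_mem R.chi R.chi' hnot)
    · rintro o ⟨t, ht, t', ht', γ, rfl, hfγ⟩
      exact hiso t (subset_closure ht) t' (subset_closure ht') γ (hsupp (subset_tsupport _ hfγ))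
  rw [Jc_eq_orbital_of_isolated W R μ DG fdG compG compT compT' hc hu hc' hu' ⟨hconv.cont, hconv.compact⟩ hgeo]
  exact hne

/-- **The weak W5 in convolution form, cocompactness and the regular element by name** (for any Haar measure `μ`
on `G(𝔸)`). -/
theorem exists_pair_test_Jc_conv_ne_zero (μ : Measure (GA W)) [μ.IsHaarMeasure]
    (compT : IsCompact (closure R.DT)) (compT' : IsCompact (closure R.DT')) (hW : IsDefinite W) (hg : IsGenuineRow W)
    (hc : Continuous R.chi) (hu : ∀ a, ‖R.chi a‖ = 1) (hc' : Continuous R.chi') (hu' : ∀ a, ‖R.chi' a‖ = 1) :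
    ∃ (DG : Set (GA W)) (fdG : IsFundamentalDomain (rationalPoints W) DG μ) (compG : IsCompact (closure DG))
      (f₁ f₂ : GA W → ℂ), IsTestFn W f₁ ∧ IsTestFn W f₂ ∧
      R.Jc ((Setting.ofAdelicData W R μ DG fdG compG compT compT').conv f₁ f₂) ≠ 0 := by
  obtain ⟨DG, fdG, compG⟩ := quotient_compact_genuine W hW hg μ
  obtain ⟨γ₀, hreg⟩ := exists_regular_rational W hW hg
  exact ⟨DG, fdG, compG,
    exists_pair_test_Jc_conv_ne_zero_of_data W R μ DG fdG compG compT compT' hW hg hc hu hc' hu' γ₀ hreg⟩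

end Pair

end Summit.Ventures.HodgeRepro.Tier4.Line4

end
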